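import Mathlib
import Summits.ResolutionOfSingularities.ResolutionOfSingularities.Theorems.WeightedInvariantLocalWeightedDropNCResSettingAdmissible
import Summits.ResolutionOfSingularities.ResolutionOfSingularities.Theorems.WeightedInvariantLocalWeightedDropWeierstrassForm
import Summits.ResolutionOfSingularities.ResolutionOfSingularities.Theorems.WeightedInvariantLocalWeightedDropWildMonicWideExit

/-!
# `WeightedInvariant.LocalWeightedDrop`, TOT2-LINE inner assembly, sub-regime «`y ∈ O`»: **THE OLD LETTER IS THE CONTACT LETTER**

Crux item stmt-ResolutionOfSingularities-8899 `LocalWeightedDrop` (route `ResolutionOfSingularities/WeightedInvariant`), ENGINE skeleton v32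
(ddb48572591139d5), registered stub `stub_spaceNCRankDrop`; TOT2-LINE v1.2 (`L/res-L1-w43-lead-1/g4/TOT2-LINE.md`), inner assembly, QUESTION Q6
of res-L1-w43-lead-1 (13:56Z): «in regime `e = 2` with the product trick, the O-letters straightened by `Φ₀` divide `U·P` with `P = y^d + Σ A_j y^j`,
so `σ(O) ⊆ {y}` and `|O| ≤ 1` (a u-letter cannot divide `P`); if the old component IS `{y = 0}`: `A₀ = 0`».  This file is that sentence in the
kernel, on res-L1-w43-stub-1's settings layer (…NCResSettingDefs/…Admissible: `Decoration`, `IsBPermissible`, `strIdx`, `strIdx_injOn`) and the monic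
forms of the `WildMonic`/`WeierstrassForm` files.  [OURS · L1 W4.3 · chain w43 · stub worker res-L1-w43-stub-2 (gen 5); nothing here is a statement
of any manuscript; AI-produced, gate-checked, weaker than expert review.  Definition-free.]

SETTING.  A decorated state `δ = (f, E, O)` PRESENTED by a boundary-straightening move `(Φ₀, w)` (`IsBPermissible δ Φ₀ w` — only its (P3) is used)
as `(f · ∏_{l∈O} x_l) ∘ Φ₀ = U · (y^d + Σ_{j<d} A_j y^j)` with `U(0) ≠ 0` (every dimension `m`, `y = X (Fin.last m)`).
* `not_X_dvd_of_constantCoeff_ne_zero'` — a unit is divisible by no letter; `not_X_castSucc_dvd_monicForm` — no `u`-letter divides a monic form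
  (its `y^d`-coefficient is `1`); `apply_zero_eq_zero_of_X_last_dvd_monicForm` — `y ∣ y^d + Σ A_j y^j` ⇒ `A₀ = 0` (`d ≥ 1`);
* **`strIdx_eq_last_of_presentation`** — every OLD letter straightens to `y`: `∀ l ∈ O, strIdx Φ₀ l = Fin.last m`;
* **`card_O_le_one_of_presentation`** — hence `|O| ≤ 1` (`strIdx` is injective on the boundary);
* **`apply_zero_eq_zero_of_presentation`** — and if `O ≠ ∅` then `A₀ = 0`: the label is in the PREP-FREE sub-regime of the lazy strategy
  (`PolyDescent.wellPrepared_of_apply_zero_eq_zero`, `PolyDescent.mem_succTWP_iff_of_apply_zero_eq_zero` of …PolyDescentSelDefs).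
-/

set_option linter.dupNamespace false -- mandated namespace of this single-conjunct summit

noncomputable section

namespace Summit.ResolutionOfSingularities.ResolutionOfSingularities.Theorems

namespace TameFourTupleDrop

open MvPowerSeries Literature.AlgebraicGeometry.Resolution

variable {k : Type} [Field k] {m : ℕ}

/-! ## Letters dividing units and monic forms -/

/-- A series with non-zero constant term is divisible by no letter. -/
theorem not_X_dvd_of_constantCoeff_ne_zero' {n : ℕ} (l : Fin n) {U : MvPowerSeries (Fin n) k} (hU : constantCoeff U ≠ 0) :
    ¬ X l ∣ U := by
  rintro ⟨V, hV⟩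
  apply hU
  rw [hV, map_mul, constantCoeff_X, zero_mul]

/-- **NO `u`-LETTER DIVIDES A MONIC FORM**: the `y^d`-coefficient of `y^d + Σ A_j y^j` is `1`, but every monomial of a multiple of `u_i` contains `u_i`. -/
theorem not_X_castSucc_dvd_monicForm {d : ℕ} (i : Fin m) (A : Fin d → MvPowerSeries (Fin m) k) :
    ¬ X (Fin.castSucc i) ∣ (X (Fin.last m) ^ d + ∑ j : Fin d, rename (Fin.succAboveEmb (Fin.last m)) (A j) * X (Fin.last m) ^ (j : ℕ)) := by
  classical
  rintro ⟨Q, hQ⟩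
  have h := WildMonic.coeff_single_last_monicForm (m := m) (k := k) A
  rw [hQ, X_def, coeff_monomial_mul, if_neg] at h
  · exact zero_ne_one h
  · intro hle
    have h1 := hle (Fin.castSucc i)
    rw [Finsupp.single_eq_same, Finsupp.single_eq_of_ne (Fin.castSucc_lt_last i).ne] at h1
    exact Nat.not_succ_le_zero 0 h1

/-- **`y ∣ y^d + Σ A_j y^j` FORCES `A₀ = 0`** (`d ≥ 1`): the `u^β y^0`-coefficient of the monic form is the `u^β`-coefficient of `A₀`. -/
theorem apply_zero_eq_zero_of_X_last_dvd_monicForm {d : ℕ} (hd : 0 < d) (A : Fin d → MvPowerSeries (Fin m) k)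
    (h : X (Fin.last m) ∣ (X (Fin.last m) ^ d + ∑ j : Fin d, rename (Fin.succAboveEmb (Fin.last m)) (A j) * X (Fin.last m) ^ (j : ℕ))) :
    A ⟨0, hd⟩ = 0 := by
  classical
  obtain ⟨Q, hQ⟩ := h
  ext β
  have hc := WeierstrassForm.coeff_monicForm A β 0
  rw [hQ, X_def, coeff_monomial_mul, if_neg, if_neg (by omega), zero_add] at hc
  · rw [map_zero]
    have hsum : ∑ j : Fin d, (if (j : ℕ) = 0 then coeff β (A j) else 0) = coeff β (A ⟨0, hd⟩) := by
      rw [Finset.sum_eq_single (⟨0, hd⟩ : Fin d)]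
      · rw [if_pos rfl]
      · intro j _ hj
        exact if_neg fun h0 => hj (Fin.ext h0)
      · intro h
        exact absurd (Finset.mem_univ _) h
    rw [hsum] at hc
    exact hc.symm
  · intro hle
    have h1 := hle (Fin.last m)
    rw [Finsupp.single_eq_same, TschirnhausForm.emb_add_single_last] at h1
    exact Nat.not_succ_le_zero 0 h1

/-! ## The old letters of a presented decorated state -/

section Presentation

variable {δ : Decoration k m} {Φ₀ : Fin (m + 1) → MvPowerSeries (Fin (m + 1)) k} {w : Fin (m + 1) → ℕ} {d : ℕ}
  {A : Fin d → MvPowerSeries (Fin m) k} {U : MvPowerSeries (Fin (m + 1)) k}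

/-- The straightened image of an old letter divides the presented form. -/
theorem X_strIdx_dvd_of_presentation (hperm : IsBPermissible δ Φ₀ w) (hU : constantCoeff U ≠ 0)
    (hP : subst Φ₀ (δ.f * ∏ l ∈ δ.O, X l) =
      U * (X (Fin.last m) ^ d + ∑ j : Fin d, rename (Fin.succAboveEmb (Fin.last m)) (A j) * X (Fin.last m) ^ (j : ℕ)))
    {l : Fin (m + 1)} (hl : l ∈ δ.O) :
    X (strIdx Φ₀ l) ∣ (X (Fin.last m) ^ d + ∑ j : Fin d, rename (Fin.succAboveEmb (Fin.last m)) (A j) * X (Fin.last m) ^ (j : ℕ)) := by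
  have hΦs : HasSubst Φ₀ := hasSubst_of_constantCoeff_zero hperm.1.1
  obtain ⟨u, -, hul⟩ := strIdx_spec (hperm.2.2.2 l (δ.O_subset hl))
  -- `Φ₀ l` divides the presented product
  have hprod : subst Φ₀ (δ.f * ∏ l ∈ δ.O, X l) = subst Φ₀ δ.f * ∏ l ∈ δ.O, Φ₀ l := by
    rw [← coe_substAlgHom hΦs, map_mul, map_prod]
    simp only [coe_substAlgHom, subst_X hΦs]
  have hdvd : Φ₀ l ∣ subst Φ₀ (δ.f * ∏ l ∈ δ.O, X l) := by
    rw [hprod]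
    exact Dvd.dvd.mul_left (Finset.dvd_prod_of_mem (fun l' => Φ₀ l') hl) _
  rw [hP, hul] at hdvd
  have hX : X (strIdx Φ₀ l) ∣ U * (X (Fin.last m) ^ d +
      ∑ j : Fin d, rename (Fin.succAboveEmb (Fin.last m)) (A j) * X (Fin.last m) ^ (j : ℕ)) :=
    dvd_trans (Dvd.intro_left u rfl) hdvd
  rcases (MvPowerSeries.prime_X' k (strIdx Φ₀ l)).dvd_or_dvd hX with h | h
  · exact absurd h (not_X_dvd_of_constantCoeff_ne_zero' _ hU)
  · exact h

/-- **EVERY OLD LETTER STRAIGHTENS TO THE CONTACT LETTER `y`.**  If `(f · ∏_{l∈O} x_l) ∘ Φ₀ = U · (y^d + Σ A_j y^j)` with `U(0) ≠ 0` and `Φ₀`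
straightens the boundary, then `strIdx Φ₀ l = Fin.last m` for every `l ∈ O` (a `u`-letter cannot divide the monic form). -/
theorem strIdx_eq_last_of_presentation (hperm : IsBPermissible δ Φ₀ w) (hU : constantCoeff U ≠ 0)
    (hP : subst Φ₀ (δ.f * ∏ l ∈ δ.O, X l) =
      U * (X (Fin.last m) ^ d + ∑ j : Fin d, rename (Fin.succAboveEmb (Fin.last m)) (A j) * X (Fin.last m) ^ (j : ℕ))) :
    ∀ l ∈ δ.O, strIdx Φ₀ l = Fin.last m := by
  intro l hl
  have h := X_strIdx_dvd_of_presentation hperm hU hP hl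
  rcases Fin.eq_castSucc_or_eq_last (strIdx Φ₀ l) with ⟨i, hi⟩ | hlast
  · rw [hi] at h
    exact absurd h (not_X_castSucc_dvd_monicForm i A)
  · exact hlast

/-- **HENCE AT MOST ONE OLD LETTER**: `|O| ≤ 1` (`strIdx Φ₀` is injective on the boundary, `strIdx_injOn`). -/
theorem card_O_le_one_of_presentation (hperm : IsBPermissible δ Φ₀ w) (hU : constantCoeff U ≠ 0)
    (hP : subst Φ₀ (δ.f * ∏ l ∈ δ.O, X l) =
      U * (X (Fin.last m) ^ d + ∑ j : Fin d, rename (Fin.succAboveEmb (Fin.last m)) (A j) * X (Fin.last m) ^ (j : ℕ))) :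
    δ.O.card ≤ 1 := by
  rw [Finset.card_le_one]
  intro l₁ h₁ l₂ h₂
  have e₁ := strIdx_eq_last_of_presentation hperm hU hP l₁ h₁
  have e₂ := strIdx_eq_last_of_presentation hperm hU hP l₂ h₂
  exact strIdx_injOn hperm (δ.O_subset h₁) (δ.O_subset h₂) (e₁.trans e₂.symm)

/-- **AND IF THERE IS AN OLD LETTER THEN `A₀ = 0`** (`d ≥ 1`): the old component is `{y = 0}`, `y` divides the monic form — the label lies in the
PREP-FREE sub-regime of the lazy strategy (`PolyDescent.wellPrepared_of_apply_zero_eq_zero`, …PolyDescentSelDefs). -/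
theorem apply_zero_eq_zero_of_presentation (hperm : IsBPermissible δ Φ₀ w) (hU : constantCoeff U ≠ 0)
    (hP : subst Φ₀ (δ.f * ∏ l ∈ δ.O, X l) =
      U * (X (Fin.last m) ^ d + ∑ j : Fin d, rename (Fin.succAboveEmb (Fin.last m)) (A j) * X (Fin.last m) ^ (j : ℕ)))
    (hd : 0 < d) (hO : δ.O.Nonempty) : A ⟨0, hd⟩ = 0 := by
  obtain ⟨l, hl⟩ := hO
  have h := X_strIdx_dvd_of_presentation hperm hU hP hl
  rw [strIdx_eq_last_of_presentation hperm hU hP l hl] at h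
  exact apply_zero_eq_zero_of_X_last_dvd_monicForm hd A h

/-- The old letter itself, read back: for `l ∈ O`, `Φ₀ l = u · y` with `u(0) ≠ 0`. -/
theorem exists_apply_eq_unit_mul_X_last_of_presentation (hperm : IsBPermissible δ Φ₀ w) (hU : constantCoeff U ≠ 0)
    (hP : subst Φ₀ (δ.f * ∏ l ∈ δ.O, X l) =
      U * (X (Fin.last m) ^ d + ∑ j : Fin d, rename (Fin.succAboveEmb (Fin.last m)) (A j) * X (Fin.last m) ^ (j : ℕ)))
    {l : Fin (m + 1)} (hl : l ∈ δ.O) : ∃ u : MvPowerSeries (Fin (m + 1)) k, constantCoeff u ≠ 0 ∧ Φ₀ l = u * X (Fin.last m) := by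
  obtain ⟨u, hu, hul⟩ := strIdx_spec (hperm.2.2.2 l (δ.O_subset hl))
  rw [strIdx_eq_last_of_presentation hperm hU hP l hl] at hul
  exact ⟨u, hu, hul⟩

end Presentation

end TameFourTupleDrop

end Summit.ResolutionOfSingularities.ResolutionOfSingularities.Theorems

end
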